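import Summits.SmoothPoincare4.SmoothPoincare4.Theorems.ConvexBisectionAcyclicBisectionExistsKasLoops
import Summits.SmoothPoincare4.SmoothPoincare4.Theorems.ConvexBisectionAcyclicBisectionExistsKasMirror
import HarnessLib

/-!
# Kas' meridian classes under mirroring (W4-G, file C, landed by W5-A; sub-goal
# `stub_Kas_mirror_classes` of stub `stub_modelsOn_counts`, line `modp-braid-orbits`, crux
# `ConvexBisection.AcyclicBisectionExists`, stmt-SmoothPoincare4-10508)

`seamOff (mirrorFamily h p) = seamOff h`; under this identification the longitude classes agree
(`map_longClass_mirrorFamily`) and the meridian class of a mirrored handle is the opposite class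
(`map_merClass_mirrorFamily`).  No new statement; proofs only.
-/

noncomputable section

set_option linter.dupNamespace false

open scoped Manifold ContDiff Topology
open Set Function Metric
open Literature.Topology.FourManifolds Literature.Topology.FourManifolds.LefschetzBase
  Literature.AlgebraicTopology.SingularHomology Literature.Topology.FourManifolds.HandleAttachingMap

namespace Summit.SmoothPoincare4.SmoothPoincare4.Theorems.AcyclicBisectionExists.ModpBraidOrbits

section MirrorClasses

variable {g : ℕ} {ι : Type*} [Finite ι]

/-- **The seam off the cores does not see the mirroring.** [folklore] -/
theorem seamOff_mirrorFamily (h : ι → HandleAttachingMap 3 2 (Base g)) (p : ι → Bool) :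
    seamOff (mirrorFamily h p) = seamOff h := by
  rw [seamOff, seamOff, coe_coresComplement_mirrorFamily]


/-- **The mirror fixes the longitude points** `(θ, θ₀)/√2` of the Clifford torus (`x₃ = sin 0 = 0`).
[folklore] -/
theorem tubeCongr_mirrorIso_cliffordPt_baseAngle (b : Bool) (θ : (Metric.sphere (0 : EuclideanSpace ℝ (Fin 2)) 1)) :
    tubeCongr (mirrorIso b) (isHandleSymmetry_mirrorIso b) (cliffordPt θ baseAngle) = cliffordPt θ baseAngle := by
  refine tubeCongr_mirrorIso_eq_self b ?_
  show cliffordVec θ baseAngle 3 = 0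
  simp [cliffordVec, baseAngle_apply_one]

/-- **The mirror conjugates the meridian points**: `(θ₀, φ)/√2 ↦ (θ₀, φ̄)/√2`. [folklore] -/
theorem tubeCongr_mirrorIso_true_cliffordPt (θ φ : (Metric.sphere (0 : EuclideanSpace ℝ (Fin 2)) 1)) :
    tubeCongr (mirrorIso true) (isHandleSymmetry_mirrorIso true) (cliffordPt θ φ) = cliffordPt θ (conjPt φ) := by
  apply Subtype.ext; apply Subtype.ext
  rw [coe_coe_tubeCongr]
  show mirrorIso true (cliffordVec θ φ) = cliffordVec θ (conjPt φ)
  ext i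
  rw [mirrorIso_true_apply]
  fin_cases i <;> simp [mirrorSign, cliffordVec, conjPt, neg_div]


/-- **The mirror does not move the longitude loop** (pointwise, as points of the base). [folklore] -/
theorem coe_longMap_mirrorFamily {h : ι → HandleAttachingMap 3 2 (Base g)}
    (hdisj : Pairwise fun i j => Disjoint (range (h i).toFun) (range (h j).toFun)) (p : ι → Bool)
    (hdisj' : Pairwise fun i j => Disjoint (range (mirrorFamily h p i).toFun) (range (mirrorFamily h p j).toFun))
    (i : ι) (θ : (Metric.sphere (0 : EuclideanSpace ℝ (Fin 2)) 1)) :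
    ((longMap hdisj' i θ : ↥(seamOff (mirrorFamily h p))) : Base g) = (longMap hdisj i θ : Base g) := by
  show (mirrorMap (h i) (p i)).toFun (cliffordPt θ baseAngle) = (h i).toFun (cliffordPt θ baseAngle)
  rw [mirrorMap_apply, tubeCongr_mirrorIso_cliffordPt_baseAngle]

/-- **The mirror reverses the meridian loop** of a selected handle: `m'ᵢ(φ) = mᵢ(φ̄)`. [folklore] -/
theorem coe_merMap_mirrorFamily {h : ι → HandleAttachingMap 3 2 (Base g)}
    (hdisj : Pairwise fun i j => Disjoint (range (h i).toFun) (range (h j).toFun)) (p : ι → Bool)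
    (hdisj' : Pairwise fun i j => Disjoint (range (mirrorFamily h p i).toFun) (range (mirrorFamily h p j).toFun))
    {i : ι} (hi : p i = true) (φ : (Metric.sphere (0 : EuclideanSpace ℝ (Fin 2)) 1)) :
    ((merMap hdisj' i φ : ↥(seamOff (mirrorFamily h p))) : Base g) = (merMap hdisj i (conjPt φ) : Base g) := by
  show (mirrorMap (h i) (p i)).toFun (cliffordPt baseAngle φ) = (h i).toFun (cliffordPt baseAngle (conjPt φ))
  rw [mirrorMap_apply, hi, tubeCongr_mirrorIso_true_cliffordPt]


variable {h : ι → HandleAttachingMap 3 2 (Base g)}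

/-- **The longitude classes are mirror-invariant**: `ℓ'ᵢ = ℓᵢ` under the identification of the
seams (any proof `e` of their equality, e.g. `seamOff_mirrorFamily h p`). [folklore] -/
theorem map_longClass_mirrorFamily
    (hdisj : Pairwise fun i j => Disjoint (range (h i).toFun) (range (h j).toFun)) (p : ι → Bool)
    (hdisj' : Pairwise fun i j => Disjoint (range (mirrorFamily h p i).toFun) (range (mirrorFamily h p j).toFun))
    (e : seamOff (mirrorFamily h p) = seamOff h) (i : ι) :
    singularHomology.map ℤ ℤ (Homeomorph.setCongr e : C(↥(seamOff (mirrorFamily h p)), ↥(seamOff h))) 1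
        (longClass hdisj' i) = longClass hdisj i := by
  rw [longClass, longClass, map_loopClass]
  refine loopClass_eq_of_coe_eq ℤ _ _ (funext fun s => Subtype.ext ?_)
  exact coe_longMap_mirrorFamily hdisj p hdisj' i (circlePt s)

/-- **The meridian class of a mirrored handle is the OPPOSITE class**: `m'ᵢ = −mᵢ` for `p i = true`
(and `m'ᵢ = mᵢ` for `p i = false`). [folklore] -/
theorem map_merClass_mirrorFamily
    (hdisj : Pairwise fun i j => Disjoint (range (h i).toFun) (range (h j).toFun)) (p : ι → Bool)
    (hdisj' : Pairwise fun i j => Disjoint (range (mirrorFamily h p i).toFun) (range (mirrorFamily h p j).toFun))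
    (e : seamOff (mirrorFamily h p) = seamOff h) (i : ι) :
    singularHomology.map ℤ ℤ (Homeomorph.setCongr e : C(↥(seamOff (mirrorFamily h p)), ↥(seamOff h))) 1
        (merClass hdisj' i) = (if p i then -merClass hdisj i else merClass hdisj i) := by
  rw [merClass, merClass, map_loopClass]
  cases hi : p i
  · rw [if_neg (by simp)]
    refine loopClass_eq_of_coe_eq ℤ _ _ (funext fun s => Subtype.ext ?_)
    show (mirrorMap (h i) (p i)).toFun (cliffordPt baseAngle (circlePt s)) =
      (h i).toFun (cliffordPt baseAngle (circlePt s))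
    rw [hi, mirrorMap_false]
  · rw [if_pos rfl, ← loopClass_loopPath_comp_conjPt (merMap hdisj i) (continuous_merMap hdisj i)]
    refine loopClass_eq_of_coe_eq ℤ _ _ (funext fun s => Subtype.ext ?_)
    exact coe_merMap_mirrorFamily hdisj p hdisj' hi (circlePt s)

/-! ## The registered sub-goal -/

/-- **Sub-goal `stub_Kas_mirror_classes` of stub `stub_modelsOn_counts`** (line `modp-braid-orbits`;
wave 5, W5-A, file of W4-G): under the identification `seamOff (mirrorFamily h p) = seamOff h` of the
seams off the cores, the longitude class of every handle is unchanged and the meridian class of a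
MIRRORED handle (`p i = true`) is the opposite class — the bookkeeping that lets Kas' (F′∧G′)
normalise the orientation characters of the handles of a Lefschetz link. [folklore] -/
theorem stub_Kas_mirror_classes :
    ∀ (g : ℕ) (ι : Type) [Finite ι]
      (h : ι → Literature.Topology.FourManifolds.HandleAttachingMap 3 2
        (Literature.Topology.FourManifolds.LefschetzBase.Base g)) (p : ι → Bool)
      (hdisj : Pairwise fun i j => Disjoint (Set.range (h i).toFun) (Set.range (h j).toFun))
      (hdisj' : Pairwise fun i j =>
        Disjoint (Set.range (Summit.SmoothPoincare4.SmoothPoincare4.Theorems.AcyclicBisectionExists.ModpBraidOrbits.mirrorFamily h p i).toFun)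
          (Set.range (Summit.SmoothPoincare4.SmoothPoincare4.Theorems.AcyclicBisectionExists.ModpBraidOrbits.mirrorFamily h p j).toFun))
      (e : Summit.SmoothPoincare4.SmoothPoincare4.Theorems.AcyclicBisectionExists.ModpBraidOrbits.seamOff
          (Summit.SmoothPoincare4.SmoothPoincare4.Theorems.AcyclicBisectionExists.ModpBraidOrbits.mirrorFamily h p) =
        Summit.SmoothPoincare4.SmoothPoincare4.Theorems.AcyclicBisectionExists.ModpBraidOrbits.seamOff h)
      (i : ι),
      Literature.AlgebraicTopology.SingularHomology.singularHomology.map ℤ ℤ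
          (Homeomorph.setCongr e :
            C(↥(Summit.SmoothPoincare4.SmoothPoincare4.Theorems.AcyclicBisectionExists.ModpBraidOrbits.seamOff
                (Summit.SmoothPoincare4.SmoothPoincare4.Theorems.AcyclicBisectionExists.ModpBraidOrbits.mirrorFamily h p)),
              ↥(Summit.SmoothPoincare4.SmoothPoincare4.Theorems.AcyclicBisectionExists.ModpBraidOrbits.seamOff h))) 1
          (Summit.SmoothPoincare4.SmoothPoincare4.Theorems.AcyclicBisectionExists.ModpBraidOrbits.longClass hdisj' i) =
        Summit.SmoothPoincare4.SmoothPoincare4.Theorems.AcyclicBisectionExists.ModpBraidOrbits.longClass hdisj i ∧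
      Literature.AlgebraicTopology.SingularHomology.singularHomology.map ℤ ℤ
          (Homeomorph.setCongr e :
            C(↥(Summit.SmoothPoincare4.SmoothPoincare4.Theorems.AcyclicBisectionExists.ModpBraidOrbits.seamOff
                (Summit.SmoothPoincare4.SmoothPoincare4.Theorems.AcyclicBisectionExists.ModpBraidOrbits.mirrorFamily h p)),
              ↥(Summit.SmoothPoincare4.SmoothPoincare4.Theorems.AcyclicBisectionExists.ModpBraidOrbits.seamOff h))) 1
          (Summit.SmoothPoincare4.SmoothPoincare4.Theorems.AcyclicBisectionExists.ModpBraidOrbits.merClass hdisj' i) =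
        (if p i then -Summit.SmoothPoincare4.SmoothPoincare4.Theorems.AcyclicBisectionExists.ModpBraidOrbits.merClass hdisj i
          else Summit.SmoothPoincare4.SmoothPoincare4.Theorems.AcyclicBisectionExists.ModpBraidOrbits.merClass hdisj i) := by
  intro g ι _ h p hdisj hdisj' e i
  exact ⟨map_longClass_mirrorFamily hdisj p hdisj' e i, map_merClass_mirrorFamily hdisj p hdisj' e i⟩

end MirrorClasses

end Summit.SmoothPoincare4.SmoothPoincare4.Theorems.AcyclicBisectionExists.ModpBraidOrbits

end
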